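import Summits.Ventures.DiscreteObjects.PP12.FanoFiveOrbitMatrix
import Mathlib.Algebra.Order.BigOperators.Group.Finset

/-!
# The order-5 orbit-matrix statement is a FINITE statement: entries are at most 2, tangent rows/columns are 0/1 (kernel; bookkeeping for the engines)
Framing: lottery ticket; floor = certified bounds/negative ranges.

Cell pub-namedobj (venture DiscreteObjects), target (M), designs gen 15; the order-5 sibling of `FlagOrbitFinite` (p345763).
`IsFanoFiveOrbitMatrix M` (`FanoFiveOrbitMatrix`, p350564) quantifies over `M : F5Idx → F5Idx → ℕ`; the row totals and row norms bound every
entry by `2` (`IsFanoFiveOrbitMatrix.entry_le_two`: an entry `a ≥ 3` would give `Σ M² ≥ Σ M + 2a ≥ Σ M + 6`, but `Σ M² ≤ Σ M + 4` for every row),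
tangent rows and tangent columns have norm = total = `12`, so they are `0/1` (`entry_le_one_of_tangent_row/col`), and an exterior row has
`Σ M² = Σ M + 4` (`exterior_row_sq`), i.e. exactly two entries `2` and otherwise `0/1`. Hence `NoFanoFiveOrbitMatrix` is equivalent to a statement
over the FINITE type `F5Idx → F5Idx → Fin 3` (`noFanoFiveOrbitMatrix_iff_fin`) — the form an exhaustive / SAT engine decides and a kernel
certificate would take (`3 ^ 900` candidates: no `decide`). Nothing here decides `NoFanoFiveOrbitMatrix`. No `sorry`, no new axioms.
-/

namespace Summit.Ventures.DiscreteObjects.PP12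

open Finset

namespace IsFanoFiveOrbitMatrix

variable {M : F5Idx → F5Idx → ℕ}

/-- Row norm exceeds row total by at most `4`: `Σ_c M r c · M r c ≤ Σ_c M r c + 4` (equality for exterior rows, norm = total for tangent rows). -/
theorem row_sq_le_sum_add_four (h : IsFanoFiveOrbitMatrix M) (r : F5Idx) :
    ∑ c : F5Idx, M r c * M r c ≤ ∑ c : F5Idx, M r c + 4 := by
  rw [h.2.2.1 r r, h.1 r]
  rcases r with ⟨x, a⟩ | e <;> simp [FanoFive.target, FanoFive.total]

/-- Tangent rows: norm = total (`12`). -/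
theorem tangent_row_sq_eq_sum (h : IsFanoFiveOrbitMatrix M) (xa : Fin 7 × Fin 2) :
    ∑ c : F5Idx, M (Sum.inl xa) c * M (Sum.inl xa) c = ∑ c : F5Idx, M (Sum.inl xa) c := by
  rw [h.2.2.1, h.1]
  rcases xa with ⟨x, a⟩
  simp [FanoFive.target, FanoFive.total]

/-- Tangent columns: norm = total (`12`). -/
theorem tangent_col_sq_eq_sum (h : IsFanoFiveOrbitMatrix M) (xa : Fin 7 × Fin 2) :
    ∑ r : F5Idx, M r (Sum.inl xa) * M r (Sum.inl xa) = ∑ r : F5Idx, M r (Sum.inl xa) := by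
  rw [h.2.2.2, h.2.1]
  rcases xa with ⟨x, a⟩
  simp [FanoFive.target, FanoFive.total]

/-- Exterior rows: `Σ_c M² = Σ_c M + 4` — exactly two entries `2`, the rest `0/1`. -/
theorem exterior_row_sq (h : IsFanoFiveOrbitMatrix M) (e : Fin 16) :
    ∑ c : F5Idx, M (Sum.inr e) c * M (Sum.inr e) c = ∑ c : F5Idx, M (Sum.inr e) c + 4 := by
  rw [h.2.2.1, h.1]; simp [FanoFive.target, FanoFive.total]

/-- **Every entry of an order-5 orbit matrix is at most `2`.** -/
theorem entry_le_two (h : IsFanoFiveOrbitMatrix M) (r c₀ : F5Idx) : M r c₀ ≤ 2 := by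
  by_contra hlt
  push Not at hlt
  have hsq := row_sq_le_sum_add_four h r
  have h1 : ∑ c : F5Idx, M r c * M r c = M r c₀ * M r c₀ + ∑ c ∈ univ.erase c₀, M r c * M r c :=
    (Finset.add_sum_erase univ (fun c => M r c * M r c) (mem_univ c₀)).symm
  have h2 : ∑ c : F5Idx, M r c = M r c₀ + ∑ c ∈ univ.erase c₀, M r c :=
    (Finset.add_sum_erase univ (fun c => M r c) (mem_univ c₀)).symm
  have h3 : ∑ c ∈ univ.erase c₀, M r c ≤ ∑ c ∈ univ.erase c₀, M r c * M r c :=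
    Finset.sum_le_sum fun c _ => Nat.le_mul_self (M r c)
  have h4 : 3 * M r c₀ ≤ M r c₀ * M r c₀ := Nat.mul_le_mul_right _ hlt
  rw [h1, h2] at hsq
  omega

/-- The entry bound packaged: an orbit matrix is a function into `{0, 1, 2}`. -/
theorem entry_lt_three (h : IsFanoFiveOrbitMatrix M) (r c₀ : F5Idx) : M r c₀ < 3 :=
  Nat.lt_succ_of_le (entry_le_two h r c₀)

/-- **Tangent rows are `0/1` rows** (norm = total). -/
theorem entry_le_one_of_tangent_row (h : IsFanoFiveOrbitMatrix M) (xa : Fin 7 × Fin 2) (c₀ : F5Idx) : M (Sum.inl xa) c₀ ≤ 1 := by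
  by_contra hlt
  push Not at hlt
  have hsq := tangent_row_sq_eq_sum h xa
  set r : F5Idx := Sum.inl xa
  have h1 : ∑ c : F5Idx, M r c * M r c = M r c₀ * M r c₀ + ∑ c ∈ univ.erase c₀, M r c * M r c :=
    (Finset.add_sum_erase univ (fun c => M r c * M r c) (mem_univ c₀)).symm
  have h2 : ∑ c : F5Idx, M r c = M r c₀ + ∑ c ∈ univ.erase c₀, M r c :=
    (Finset.add_sum_erase univ (fun c => M r c) (mem_univ c₀)).symm
  have h3 : ∑ c ∈ univ.erase c₀, M r c ≤ ∑ c ∈ univ.erase c₀, M r c * M r c :=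
    Finset.sum_le_sum fun c _ => Nat.le_mul_self (M r c)
  have h4 : 2 * M r c₀ ≤ M r c₀ * M r c₀ := Nat.mul_le_mul_right _ hlt
  rw [h1, h2] at hsq
  omega

/-- **Tangent columns are `0/1` columns** (norm = total). -/
theorem entry_le_one_of_tangent_col (h : IsFanoFiveOrbitMatrix M) (r₀ : F5Idx) (xa : Fin 7 × Fin 2) : M r₀ (Sum.inl xa) ≤ 1 := by
  by_contra hlt
  push Not at hlt
  have hsq := tangent_col_sq_eq_sum h xa
  set c : F5Idx := Sum.inl xa
  have h1 : ∑ r : F5Idx, M r c * M r c = M r₀ c * M r₀ c + ∑ r ∈ univ.erase r₀, M r c * M r c :=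
    (Finset.add_sum_erase univ (fun r => M r c * M r c) (mem_univ r₀)).symm
  have h2 : ∑ r : F5Idx, M r c = M r₀ c + ∑ r ∈ univ.erase r₀, M r c :=
    (Finset.add_sum_erase univ (fun r => M r c) (mem_univ r₀)).symm
  have h3 : ∑ r ∈ univ.erase r₀, M r c ≤ ∑ r ∈ univ.erase r₀, M r c * M r c :=
    Finset.sum_le_sum fun r _ => Nat.le_mul_self (M r c)
  have h4 : 2 * M r₀ c ≤ M r₀ c * M r₀ c := Nat.mul_le_mul_right _ hlt
  rw [h1, h2] at hsq
  omega

end IsFanoFiveOrbitMatrix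

/-- **`NoFanoFiveOrbitMatrix` is a statement about the FINITE type `F5Idx → F5Idx → Fin 3`** (entries `0, 1, 2`). -/
theorem noFanoFiveOrbitMatrix_iff_fin :
    NoFanoFiveOrbitMatrix ↔ ∀ M : F5Idx → F5Idx → Fin 3, ¬ IsFanoFiveOrbitMatrix (fun r c => (M r c : ℕ)) := by
  constructor
  · intro h M hM
    exact h _ hM
  · intro h M hM
    refine h (fun r c => ⟨M r c, IsFanoFiveOrbitMatrix.entry_lt_three hM r c⟩) ?_
    exact hM

/-- The finite type of candidate matrices is indeed a `Fintype`. -/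
example : Fintype (F5Idx → F5Idx → Fin 3) := inferInstance

end Summit.Ventures.DiscreteObjects.PP12
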